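import Summits.SmoothPoincare4.SmoothPoincare4.Theorems.DottedCircleRasmussenDcrGapHelperFriendsCarrierVkFlowTube
import Literature.Topology.FourManifolds.SliceDiscConicalFramingExistence

/-!
# Helper `helper_friendsCarrier_Vk_partB_flowOut` (piece of the registered stub
`helper_friendsCarrier_Vk_partB`, line `mk_friends`, skeleton v8) for crux `DcrGap`
(item stmt-SmoothPoincare4-16128, route route-SmoothPoincare4-DottedCircleRasmussen)

**The flow-out of the knot tube in Cartesian coordinates.**  For the tube `νK : 𝕊¹ × ℝ² → M_k` of the
model knot and the clocked collar flow `Φ` (`…VkClockFlow`), the tube of Part B of V_k over the boundary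
band of the disc is

  `C(x, w) = Φ(1 - ‖x‖, νK(x/‖x‖, w))`   (`x ∈ ℝ² ∖ 0`, `w ∈ ℝ²`),

the `k ≥ 1` replacement of the cone tube `‖x‖ • ν(x/‖x‖, w)` of the `k = 0` template
(`TubularNbhdConeTube.lean`).  This file proves: `C` is `C^∞` off `x = 0`; `C(t u, w) = Φ(1 - t, νK(u, w))`;
on the band `|1 - ‖x‖| < 2ε` it lies at level `G_k = 2 - ‖x‖`, is injective, and is an IMMERSION — the
immersion property of the flow-out `(s, u, w) ↦ Φ(s, νK(u, w))` on the manifold `ℝ × 𝕊¹ × ℝ²`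
(`…VkFlowTube`) transported through the local diffeomorphism `(s, u, w) ↦ ((1 - s) u, w)`, whose
differential `(σ, η, ξ) ↦ (-σ u + (1 - s) ι(η), ξ)` is injective (`ι(η) ⊥ u`), hence onto by dimension
count; and on the unit circle its fibre derivative is that of `νK` (`C(u, w) = νK(u, w)` as `Φ₀ = id`).

No definitions, no named facts, no `sorry`.
-/

-- the prescribed namespace `Summit.<P>.<Sub>.…` duplicates `SmoothPoincare4` (P = Sub)
set_option linter.dupNamespace false
set_option linter.style.longLine false

noncomputable section

open scoped Manifold ContDiff Topology RealInnerProductSpace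
open Set Function Metric Filter
open Literature.Topology.FourManifolds Literature.Topology.FourManifolds.MMSW

namespace Summit.SmoothPoincare4.SmoothPoincare4.Theorems.DcrGap.MkFriends

namespace FriendsCarrierVk


/-- The flow-out in Cartesian coordinates at a cone point: `C(t u, w) = Φ(1 - t, νK(u, w))`. [folklore] -/
theorem flowOut_smul_coe {νK : (Metric.sphere (0 : EuclideanSpace ℝ (Fin 2)) 1) × (EuclideanSpace ℝ (Fin 2)) → (EuclideanSpace ℝ (Fin 4))}
    {Φ : ℝ × (EuclideanSpace ℝ (Fin 4)) → (EuclideanSpace ℝ (Fin 4))} {t : ℝ} (ht : 0 < t)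
    (u : (Metric.sphere (0 : EuclideanSpace ℝ (Fin 2)) 1)) (w : EuclideanSpace ℝ (Fin 2)) :
    Φ (1 - ‖t • (u : EuclideanSpace ℝ (Fin 2))‖, νK (radialProjection (spherePt 1) (t • (u : EuclideanSpace ℝ (Fin 2))), w)) =
      Φ (1 - t, νK (u, w)) := by
  rw [norm_smul_coe_sphere ht.le, radialProjection_smul _ ht]

/-- **The flow-out is `C^∞` off `x = 0`.** [folklore] -/
theorem contDiffAt_flowOut {νK : (Metric.sphere (0 : EuclideanSpace ℝ (Fin 2)) 1) × (EuclideanSpace ℝ (Fin 2)) → (EuclideanSpace ℝ (Fin 4))}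
    {Φ : ℝ × (EuclideanSpace ℝ (Fin 4)) → (EuclideanSpace ℝ (Fin 4))}
    (hν : ContMDiff ((𝓡 1).prod 𝓘(ℝ, EuclideanSpace ℝ (Fin 2))) 𝓘(ℝ, EuclideanSpace ℝ (Fin 4)) ∞ νK)
    (hΦs : ContDiff ℝ ∞ Φ) {q : (EuclideanSpace ℝ (Fin 2)) × (EuclideanSpace ℝ (Fin 2))} (hq : q.1 ≠ 0) :
    ContDiffAt ℝ ∞ (fun q : (EuclideanSpace ℝ (Fin 2)) × (EuclideanSpace ℝ (Fin 2)) =>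
      Φ (1 - ‖q.1‖, νK (radialProjection (spherePt 1) q.1, q.2))) q := by
  haveI := fact_finrank_euclideanSpace_two
  -- the tube part, through the manifold `𝕊¹ × ℝ²`
  have hfst : ContMDiff 𝓘(ℝ, (EuclideanSpace ℝ (Fin 2)) × (EuclideanSpace ℝ (Fin 2))) 𝓘(ℝ, EuclideanSpace ℝ (Fin 2)) ∞
      (Prod.fst : (EuclideanSpace ℝ (Fin 2)) × (EuclideanSpace ℝ (Fin 2)) → EuclideanSpace ℝ (Fin 2)) := contDiff_fst.contMDiff
  have hsnd : ContMDiff 𝓘(ℝ, (EuclideanSpace ℝ (Fin 2)) × (EuclideanSpace ℝ (Fin 2))) 𝓘(ℝ, EuclideanSpace ℝ (Fin 2)) ∞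
      (Prod.snd : (EuclideanSpace ℝ (Fin 2)) × (EuclideanSpace ℝ (Fin 2)) → EuclideanSpace ℝ (Fin 2)) := contDiff_snd.contMDiff
  have hP : ContMDiffOn 𝓘(ℝ, (EuclideanSpace ℝ (Fin 2)) × (EuclideanSpace ℝ (Fin 2))) ((𝓡 1).prod 𝓘(ℝ, EuclideanSpace ℝ (Fin 2))) ∞
      (fun p : (EuclideanSpace ℝ (Fin 2)) × (EuclideanSpace ℝ (Fin 2)) => (radialProjection (spherePt 1) p.1, p.2)) {p | p.1 ≠ 0} :=
    ((contMDiffOn_radialProjection (spherePt 1)).comp hfst.contMDiffOn fun p hp => hp).prodMk hsnd.contMDiffOn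
  have hN : ContMDiffOn 𝓘(ℝ, (EuclideanSpace ℝ (Fin 2)) × (EuclideanSpace ℝ (Fin 2))) 𝓘(ℝ, EuclideanSpace ℝ (Fin 4)) ∞
      (fun p : (EuclideanSpace ℝ (Fin 2)) × (EuclideanSpace ℝ (Fin 2)) => νK (radialProjection (spherePt 1) p.1, p.2)) {p | p.1 ≠ 0} :=
    hν.comp_contMDiffOn hP
  have hN' : ContDiffAt ℝ ∞ (fun p : (EuclideanSpace ℝ (Fin 2)) × (EuclideanSpace ℝ (Fin 2)) => νK (radialProjection (spherePt 1) p.1, p.2)) q :=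
    (contMDiffOn_iff_contDiffOn.1 hN).contDiffAt ((isOpen_ne_fun continuous_fst continuous_const).mem_nhds hq)
  have hs : ContDiffAt ℝ ∞ (fun p : (EuclideanSpace ℝ (Fin 2)) × (EuclideanSpace ℝ (Fin 2)) => 1 - ‖p.1‖) q :=
    contDiffAt_const.sub ((contDiffAt_norm ℝ hq).comp q contDiffAt_fst)
  exact hΦs.contDiffAt.comp q (hs.prodMk hN')

/-- The fibre maps `w ↦ νK(u, w)` are `C^∞`. [folklore] -/
theorem contDiff_tube_fibre {νK : (Metric.sphere (0 : EuclideanSpace ℝ (Fin 2)) 1) × (EuclideanSpace ℝ (Fin 2)) → (EuclideanSpace ℝ (Fin 4))}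
    (hν : ContMDiff ((𝓡 1).prod 𝓘(ℝ, EuclideanSpace ℝ (Fin 2))) 𝓘(ℝ, EuclideanSpace ℝ (Fin 4)) ∞ νK)
    (u : (Metric.sphere (0 : EuclideanSpace ℝ (Fin 2)) 1)) :
    ContDiff ℝ ∞ fun w : EuclideanSpace ℝ (Fin 2) => νK (u, w) := by
  have h : ContMDiff 𝓘(ℝ, EuclideanSpace ℝ (Fin 2)) 𝓘(ℝ, EuclideanSpace ℝ (Fin 4)) ∞ fun w : EuclideanSpace ℝ (Fin 2) => νK (u, w) :=
    hν.comp (contMDiff_const.prodMk contMDiff_id)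
  exact contMDiff_iff_contDiff.1 h

/-- **On the unit circle the flow-out has the fibre derivative of the tube** (there `C(u, ·) = νK(u, ·)`,
as `Φ₀ = id`). [folklore] -/
theorem fderiv_flowOut_fibre_coe {νK : (Metric.sphere (0 : EuclideanSpace ℝ (Fin 2)) 1) × (EuclideanSpace ℝ (Fin 2)) → (EuclideanSpace ℝ (Fin 4))}
    {Φ : ℝ × (EuclideanSpace ℝ (Fin 4)) → (EuclideanSpace ℝ (Fin 4))} (h0 : ∀ x, Φ (0, x) = x)
    (u : (Metric.sphere (0 : EuclideanSpace ℝ (Fin 2)) 1)) :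
    fderiv ℝ (fun w : EuclideanSpace ℝ (Fin 2) =>
        Φ (1 - ‖(u : EuclideanSpace ℝ (Fin 2))‖, νK (radialProjection (spherePt 1) (u : EuclideanSpace ℝ (Fin 2)), w))) 0 =
      fderiv ℝ (fun w : EuclideanSpace ℝ (Fin 2) => νK (u, w)) 0 := by
  congr 1
  funext w
  rw [norm_eq_of_mem_sphere, sub_self, radialProjection_coe_sphere, h0]

set_option maxHeartbeats 800000 in
/-- **The flow-out is an immersion on the band** `|1 - ‖x‖| < 2ε`, `x ≠ 0`. [folklore] -/
theorem injective_fderiv_flowOut {k : ℕ} {νK : (Metric.sphere (0 : EuclideanSpace ℝ (Fin 2)) 1) × (EuclideanSpace ℝ (Fin 2)) → (EuclideanSpace ℝ (Fin 4))}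
    {Φ : ℝ × (EuclideanSpace ℝ (Fin 4)) → (EuclideanSpace ℝ (Fin 4))} {ε : ℝ}
    (hν : ContMDiff ((𝓡 1).prod 𝓘(ℝ, EuclideanSpace ℝ (Fin 2))) 𝓘(ℝ, EuclideanSpace ℝ (Fin 4)) ∞ νK)
    (hνi : Injective νK)
    (hνd : ∀ p, Injective (mfderiv ((𝓡 1).prod 𝓘(ℝ, EuclideanSpace ℝ (Fin 2))) 𝓘(ℝ, EuclideanSpace ℝ (Fin 4)) νK p))
    (hνM : ∀ p, νK p ∈ modelBoundary k)
    (hΦs : ContDiff ℝ ∞ Φ) (h0 : ∀ x, Φ (0, x) = x) (hadd : ∀ s t x, Φ (s, Φ (t, x)) = Φ (s + t, x))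
    (hclock : ∀ x ∈ modelBoundary k, ∀ s : ℝ, |s| ≤ 2 * ε →
      (∀ j, (1 : ℝ) / 2 < holeTerm k j (Φ (s, x))) ∧ levelFun k (Φ (s, x)) = 1 + s)
    {x w : EuclideanSpace ℝ (Fin 2)} (hx : x ≠ 0) (hs : |1 - ‖x‖| < 2 * ε) :
    Injective (fderiv ℝ (fun q : (EuclideanSpace ℝ (Fin 2)) × (EuclideanSpace ℝ (Fin 2)) =>
      Φ (1 - ‖q.1‖, νK (radialProjection (spherePt 1) q.1, q.2))) (x, w)) := by
  haveI := fact_finrank_euclideanSpace_two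
  obtain ⟨-, -, -, himm⟩ := flowTube hν hνi hνd hνM hΦs h0 hadd hclock
  set C : (EuclideanSpace ℝ (Fin 2)) × (EuclideanSpace ℝ (Fin 2)) → EuclideanSpace ℝ (Fin 4) :=
    fun q => Φ (1 - ‖q.1‖, νK (radialProjection (spherePt 1) q.1, q.2)) with hC
  set u₀ : (Metric.sphere (0 : EuclideanSpace ℝ (Fin 2)) 1) := radialProjection (spherePt 1) x with hu₀
  set s₀ : ℝ := 1 - ‖x‖ with hs₀
  have hxpos : 0 < ‖x‖ := norm_pos_iff.2 hx
  have hs₀1 : 0 < 1 - s₀ := by rw [hs₀]; linarith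
  have hxu : (1 - s₀) • (u₀ : EuclideanSpace ℝ (Fin 2)) = x := by
    rw [hs₀, sub_sub_cancel]; exact norm_smul_coe_radialProjection _ x
  set p₀ : ℝ × ((Metric.sphere (0 : EuclideanSpace ℝ (Fin 2)) 1) × EuclideanSpace ℝ (Fin 2)) := (s₀, (u₀, w)) with hp₀
  -- the factorisation `FT = C ∘ Ψ' ∘ J` near `p₀`
  set J : ℝ × ((Metric.sphere (0 : EuclideanSpace ℝ (Fin 2)) 1) × EuclideanSpace ℝ (Fin 2)) → ℝ × ((EuclideanSpace ℝ (Fin 2)) × (EuclideanSpace ℝ (Fin 2))) :=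
    fun p => (p.1, ((p.2.1 : EuclideanSpace ℝ (Fin 2)), p.2.2)) with hJ
  set Ψ' : ℝ × ((EuclideanSpace ℝ (Fin 2)) × (EuclideanSpace ℝ (Fin 2))) → (EuclideanSpace ℝ (Fin 2)) × (EuclideanSpace ℝ (Fin 2)) :=
    fun q => ((1 - q.1) • q.2.1, q.2.2) with hΨ'
  have hΨJ : Ψ' (J p₀) = (x, w) := by simp only [hΨ', hJ, hp₀, hxu]
  have hev : (fun p : ℝ × ((Metric.sphere (0 : EuclideanSpace ℝ (Fin 2)) 1) × EuclideanSpace ℝ (Fin 2)) => Φ (p.1, νK p.2)) =ᶠ[𝓝 p₀]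
      (C ∘ Ψ' ∘ J) := by
    have ho : IsOpen {p : ℝ × ((Metric.sphere (0 : EuclideanSpace ℝ (Fin 2)) 1) × EuclideanSpace ℝ (Fin 2)) | p.1 < 1} :=
      isOpen_lt continuous_fst continuous_const
    filter_upwards [ho.mem_nhds (show p₀.1 < 1 by simp only [hp₀]; linarith)] with p hp
    have h1 : 0 < 1 - p.1 := by linarith [show p.1 < 1 from hp]
    simp only [comp_apply, hC, hΨ', hJ]
    rw [flowOut_smul_coe (νK := νK) (Φ := Φ) h1, sub_sub_cancel]
  -- the derivative of `J`
  set ι := mfderiv (𝓡 1) 𝓘(ℝ, EuclideanSpace ℝ (Fin 2)) (Subtype.val : (Metric.sphere (0 : EuclideanSpace ℝ (Fin 2)) 1) → EuclideanSpace ℝ (Fin 2)) u₀ with hι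
  have hcoe : ContMDiff (𝓡 1) 𝓘(ℝ, EuclideanSpace ℝ (Fin 2)) ∞ (Subtype.val : (Metric.sphere (0 : EuclideanSpace ℝ (Fin 2)) 1) → EuclideanSpace ℝ (Fin 2)) :=
    contMDiff_coe_sphere
  have hιd : HasMFDerivAt (𝓡 1) 𝓘(ℝ, EuclideanSpace ℝ (Fin 2)) (Subtype.val : (Metric.sphere (0 : EuclideanSpace ℝ (Fin 2)) 1) → EuclideanSpace ℝ (Fin 2)) u₀ ι :=
    (hcoe.mdifferentiableAt (by simp)).hasMFDerivAt
  set I₂ := (𝓡 1).prod 𝓘(ℝ, EuclideanSpace ℝ (Fin 2)) with hI₂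
  set I₃ := 𝓘(ℝ, ℝ).prod I₂ with hI₃
  have hJ1 : HasMFDerivAt I₃ 𝓘(ℝ, ℝ) (fun p : ℝ × ((Metric.sphere (0 : EuclideanSpace ℝ (Fin 2)) 1) × EuclideanSpace ℝ (Fin 2)) => p.1) p₀
      (ContinuousLinearMap.fst ℝ (TangentSpace 𝓘(ℝ, ℝ) p₀.1) (TangentSpace I₂ p₀.2)) := hasMFDerivAt_fst _
  have hJ2 : HasMFDerivAt I₃ I₂ (fun p : ℝ × ((Metric.sphere (0 : EuclideanSpace ℝ (Fin 2)) 1) × EuclideanSpace ℝ (Fin 2)) => p.2) p₀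
      (ContinuousLinearMap.snd ℝ (TangentSpace 𝓘(ℝ, ℝ) p₀.1) (TangentSpace I₂ p₀.2)) := hasMFDerivAt_snd _
  have hJ21 : HasMFDerivAt I₂ (𝓡 1) (fun q : (Metric.sphere (0 : EuclideanSpace ℝ (Fin 2)) 1) × EuclideanSpace ℝ (Fin 2) => q.1) p₀.2
      (ContinuousLinearMap.fst ℝ (TangentSpace (𝓡 1) p₀.2.1) (TangentSpace 𝓘(ℝ, EuclideanSpace ℝ (Fin 2)) p₀.2.2)) := hasMFDerivAt_fst _
  have hJ22 : HasMFDerivAt I₂ 𝓘(ℝ, EuclideanSpace ℝ (Fin 2)) (fun q : (Metric.sphere (0 : EuclideanSpace ℝ (Fin 2)) 1) × EuclideanSpace ℝ (Fin 2) => q.2) p₀.2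
      (ContinuousLinearMap.snd ℝ (TangentSpace (𝓡 1) p₀.2.1) (TangentSpace 𝓘(ℝ, EuclideanSpace ℝ (Fin 2)) p₀.2.2)) := hasMFDerivAt_snd _
  have hJval : HasMFDerivAt I₃ 𝓘(ℝ, EuclideanSpace ℝ (Fin 2))
      (fun p : ℝ × ((Metric.sphere (0 : EuclideanSpace ℝ (Fin 2)) 1) × EuclideanSpace ℝ (Fin 2)) => (p.2.1 : EuclideanSpace ℝ (Fin 2))) p₀
      (ι.comp ((ContinuousLinearMap.fst ℝ (TangentSpace (𝓡 1) p₀.2.1) (TangentSpace 𝓘(ℝ, EuclideanSpace ℝ (Fin 2)) p₀.2.2)).comp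
        (ContinuousLinearMap.snd ℝ (TangentSpace 𝓘(ℝ, ℝ) p₀.1) (TangentSpace I₂ p₀.2)))) :=
    hιd.comp p₀ (hJ21.comp p₀ hJ2)
  have hJsnd : HasMFDerivAt I₃ 𝓘(ℝ, EuclideanSpace ℝ (Fin 2))
      (fun p : ℝ × ((Metric.sphere (0 : EuclideanSpace ℝ (Fin 2)) 1) × EuclideanSpace ℝ (Fin 2)) => p.2.2) p₀
      ((ContinuousLinearMap.snd ℝ (TangentSpace (𝓡 1) p₀.2.1) (TangentSpace 𝓘(ℝ, EuclideanSpace ℝ (Fin 2)) p₀.2.2)).comp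
        (ContinuousLinearMap.snd ℝ (TangentSpace 𝓘(ℝ, ℝ) p₀.1) (TangentSpace I₂ p₀.2))) :=
    hJ22.comp p₀ hJ2
  have hJd := hJ1.prodMk (hJval.prodMk hJsnd)
  -- the derivative of `Ψ'` at `J p₀ = (s₀, (u₀, w))`
  have hΨd : HasFDerivAt Ψ' (fderiv ℝ Ψ' (J p₀)) (J p₀) := by
    have : ContDiff ℝ ∞ Ψ' := by
      simp only [hΨ']
      exact ((contDiff_const.sub contDiff_fst).smul (contDiff_fst.comp contDiff_snd)).prodMk (contDiff_snd.comp contDiff_snd)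
    exact ((this.differentiable (by simp)) _).hasFDerivAt
  have hΨval : ∀ (σ : ℝ) (v ξ : EuclideanSpace ℝ (Fin 2)),
      fderiv ℝ Ψ' (J p₀) (σ, (v, ξ)) = (-σ • (u₀ : EuclideanSpace ℝ (Fin 2)) + (1 - s₀) • v, ξ) := by
    intro σ v ξ
    have h1 : HasFDerivAt (fun q : ℝ × ((EuclideanSpace ℝ (Fin 2)) × (EuclideanSpace ℝ (Fin 2))) => 1 - q.1)
        (0 - ContinuousLinearMap.fst ℝ ℝ ((EuclideanSpace ℝ (Fin 2)) × (EuclideanSpace ℝ (Fin 2)))) (J p₀) :=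
      (hasFDerivAt_const (1 : ℝ) _).sub hasFDerivAt_fst
    have h2 : HasFDerivAt (fun q : ℝ × ((EuclideanSpace ℝ (Fin 2)) × (EuclideanSpace ℝ (Fin 2))) => q.2.1)
        ((ContinuousLinearMap.fst ℝ (EuclideanSpace ℝ (Fin 2)) (EuclideanSpace ℝ (Fin 2))).comp
          (ContinuousLinearMap.snd ℝ ℝ ((EuclideanSpace ℝ (Fin 2)) × (EuclideanSpace ℝ (Fin 2))))) (J p₀) :=
      hasFDerivAt_fst.comp _ hasFDerivAt_snd
    have h3 : HasFDerivAt (fun q : ℝ × ((EuclideanSpace ℝ (Fin 2)) × (EuclideanSpace ℝ (Fin 2))) => q.2.2)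
        ((ContinuousLinearMap.snd ℝ (EuclideanSpace ℝ (Fin 2)) (EuclideanSpace ℝ (Fin 2))).comp
          (ContinuousLinearMap.snd ℝ ℝ ((EuclideanSpace ℝ (Fin 2)) × (EuclideanSpace ℝ (Fin 2))))) (J p₀) :=
      hasFDerivAt_snd.comp _ hasFDerivAt_snd
    have h := (h1.smul h2).prodMk h3
    have heq : fderiv ℝ Ψ' (J p₀) = _ := h.fderiv
    rw [heq]
    simp [hJ, hp₀]
    abel
  -- the chain rule for `FT = C ∘ Ψ' ∘ J`
  have hCd : HasFDerivAt C (fderiv ℝ C (x, w)) (x, w) :=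
    ((contDiffAt_flowOut hν hΦs (q := (x, w)) hx).differentiableAt (by simp)).hasFDerivAt
  have hCΨ : HasFDerivAt (C ∘ Ψ') ((fderiv ℝ C (x, w)).comp (fderiv ℝ Ψ' (J p₀))) (J p₀) := by
    have hCd' : HasFDerivAt C (fderiv ℝ C (x, w)) (Ψ' (J p₀)) := by rw [hΨJ]; exact hCd
    exact hCd'.comp _ hΨd
  have hCΨm : HasMFDerivAt 𝓘(ℝ, ℝ × ((EuclideanSpace ℝ (Fin 2)) × (EuclideanSpace ℝ (Fin 2)))) 𝓘(ℝ, EuclideanSpace ℝ (Fin 4)) (C ∘ Ψ')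
      (J p₀) ((fderiv ℝ C (x, w)).comp (fderiv ℝ Ψ' (J p₀))) := hasMFDerivAt_iff_hasFDerivAt.2 hCΨ
  have hcomp := hCΨm.comp p₀ hJd
  have hFTd := hcomp.congr_of_eventuallyEq hev
  -- the transported differential is injective, hence onto (dimension count)
  set T := (fderiv ℝ Ψ' (J p₀)).comp
    ((ContinuousLinearMap.fst ℝ (TangentSpace 𝓘(ℝ, ℝ) p₀.1) (TangentSpace I₂ p₀.2)).prod
      ((ι.comp ((ContinuousLinearMap.fst ℝ (TangentSpace (𝓡 1) p₀.2.1) (TangentSpace 𝓘(ℝ, EuclideanSpace ℝ (Fin 2)) p₀.2.2)).comp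
        (ContinuousLinearMap.snd ℝ (TangentSpace 𝓘(ℝ, ℝ) p₀.1) (TangentSpace I₂ p₀.2)))).prod
      ((ContinuousLinearMap.snd ℝ (TangentSpace (𝓡 1) p₀.2.1) (TangentSpace 𝓘(ℝ, EuclideanSpace ℝ (Fin 2)) p₀.2.2)).comp
        (ContinuousLinearMap.snd ℝ (TangentSpace 𝓘(ℝ, ℝ) p₀.1) (TangentSpace I₂ p₀.2))))) with hT
  -- `ι` as a map into the plane (the tangent space of the plane is the plane)
  set ιv : EuclideanSpace ℝ (Fin 1) → EuclideanSpace ℝ (Fin 2) := fun η => ι η with hιv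
  have hTapply : ∀ Z : ℝ × (EuclideanSpace ℝ (Fin 1) × EuclideanSpace ℝ (Fin 2)),
      T Z = (-Z.1 • (u₀ : EuclideanSpace ℝ (Fin 2)) + (1 - s₀) • ιv Z.2.1, Z.2.2) := by
    rintro ⟨σ, η, ξ⟩
    simp only [hT, ContinuousLinearMap.comp_apply]
    exact hΨval σ (ιv η) ξ
  have hTinj : ∀ Z : ℝ × (EuclideanSpace ℝ (Fin 1) × EuclideanSpace ℝ (Fin 2)), T Z = 0 → Z = 0 := by
    rintro ⟨σ, η, ξ⟩ hZ
    rw [hTapply] at hZ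
    simp only [Prod.mk_eq_zero] at hZ
    obtain ⟨h1, hξ⟩ := hZ
    -- `ι η ⊥ u₀`, so `σ = 0`
    have hperp : ⟪(u₀ : EuclideanSpace ℝ (Fin 2)), ιv η⟫ = 0 := by
      have hmem : ιv η ∈ (ℝ ∙ (u₀ : EuclideanSpace ℝ (Fin 2)))ᗮ := by
        rw [← range_mfderiv_coe_sphere (E := EuclideanSpace ℝ (Fin 2)) (n := 1) u₀]
        exact ⟨η, rfl⟩
      exact (Submodule.mem_orthogonal_singleton_iff_inner_right.1 hmem)
    have hσ : σ = 0 := by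
      have := congrArg (fun v => ⟪(u₀ : EuclideanSpace ℝ (Fin 2)), v⟫) h1
      rw [inner_zero_right, inner_add_right, inner_smul_right, inner_smul_right, hperp, mul_zero, add_zero,
        real_inner_self_eq_norm_sq, norm_eq_of_mem_sphere, one_pow, mul_one, neg_eq_zero] at this
      exact this
    subst hσ
    have hιη : ιv η = 0 := by
      rw [neg_zero, zero_smul, zero_add, smul_eq_zero] at h1
      exact h1.resolve_left hs₀1.ne'
    have hη : η = 0 := (injective_iff_map_eq_zero _).1 (mfderiv_coe_sphere_injective (n := 1) u₀) η hιη
    subst hη; subst hξ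
    rfl
  have hTinj' : Injective T := by
    intro Z Z' h
    rw [← sub_eq_zero] at h ⊢
    rw [← map_sub] at h
    exact hTinj (Z - Z') h
  haveI : FiniteDimensional ℝ (TangentSpace I₃ p₀) :=
    inferInstanceAs (FiniteDimensional ℝ (ℝ × (EuclideanSpace ℝ (Fin 1) × EuclideanSpace ℝ (Fin 2))))
  have hfin : Module.finrank ℝ (TangentSpace I₃ p₀) = Module.finrank ℝ ((EuclideanSpace ℝ (Fin 2)) × (EuclideanSpace ℝ (Fin 2))) := by
    show Module.finrank ℝ (ℝ × (EuclideanSpace ℝ (Fin 1) × EuclideanSpace ℝ (Fin 2))) = _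
    simp [Module.finrank_prod]
  have hTsurj : Surjective T :=
    (LinearMap.injective_iff_surjective_of_finrank_eq_finrank hfin).1 hTinj'
  -- conclusion
  have hp₀band : |p₀.1| < 2 * ε := by simpa only [hp₀] using hs
  have key := himm p₀ hp₀band
  refine (injective_iff_map_eq_zero _).2 fun v hv => ?_
  obtain ⟨Z, rfl⟩ := hTsurj v
  have h1 : mfderiv I₃ 𝓘(ℝ, EuclideanSpace ℝ (Fin 4))
      (fun p : ℝ × ((Metric.sphere (0 : EuclideanSpace ℝ (Fin 2)) 1) × EuclideanSpace ℝ (Fin 2)) => Φ (p.1, νK p.2)) p₀ Z = 0 := by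
    rw [hFTd.mfderiv]
    exact hv
  have hZ : Z = 0 := (injective_iff_map_eq_zero _).1 key Z h1
  rw [hZ, map_zero]

/-- **On the band the flow-out is in the clock zone at level `2 - ‖x‖`.** [folklore] -/
theorem flowOut_level {k : ℕ} {νK : (Metric.sphere (0 : EuclideanSpace ℝ (Fin 2)) 1) × (EuclideanSpace ℝ (Fin 2)) → (EuclideanSpace ℝ (Fin 4))} {Φ : ℝ × (EuclideanSpace ℝ (Fin 4)) → (EuclideanSpace ℝ (Fin 4))} {ε : ℝ}
    (hνM : ∀ p, νK p ∈ modelBoundary k)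
    (hclock : ∀ x ∈ modelBoundary k, ∀ s : ℝ, |s| ≤ 2 * ε →
      (∀ j, (1 : ℝ) / 2 < holeTerm k j (Φ (s, x))) ∧ levelFun k (Φ (s, x)) = 1 + s)
    {x : EuclideanSpace ℝ (Fin 2)} (w : EuclideanSpace ℝ (Fin 2)) (hs : |1 - ‖x‖| ≤ 2 * ε) :
    (∀ j, (1 : ℝ) / 2 < holeTerm k j (Φ (1 - ‖x‖, νK (radialProjection (spherePt 1) x, w)))) ∧
      levelFun k (Φ (1 - ‖x‖, νK (radialProjection (spherePt 1) x, w))) = 2 - ‖x‖ := by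
  have h := hclock _ (hνM (radialProjection (spherePt 1) x, w)) (1 - ‖x‖) hs
  rw [show (1 : ℝ) + (1 - ‖x‖) = 2 - ‖x‖ by ring] at h
  exact h

/-- **On the band over the open disc the flow-out misses `D_k`** (its level exceeds `1`). [folklore] -/
theorem flowOut_notMem {k : ℕ} {νK : (Metric.sphere (0 : EuclideanSpace ℝ (Fin 2)) 1) × (EuclideanSpace ℝ (Fin 2)) → (EuclideanSpace ℝ (Fin 4))} {Φ : ℝ × (EuclideanSpace ℝ (Fin 4)) → (EuclideanSpace ℝ (Fin 4))} {ε : ℝ}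
    (hνM : ∀ p, νK p ∈ modelBoundary k)
    (hclock : ∀ x ∈ modelBoundary k, ∀ s : ℝ, |s| ≤ 2 * ε →
      (∀ j, (1 : ℝ) / 2 < holeTerm k j (Φ (s, x))) ∧ levelFun k (Φ (s, x)) = 1 + s)
    {x : EuclideanSpace ℝ (Fin 2)} (w : EuclideanSpace ℝ (Fin 2)) (hs : |1 - ‖x‖| ≤ 2 * ε) (hx : ‖x‖ < 1) :
    Φ (1 - ‖x‖, νK (radialProjection (spherePt 1) x, w)) ∉ modelHandlebody k := fun h => by
  have hlev := (flowOut_level hνM hclock w hs).2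
  have h2 : levelFun k (Φ (1 - ‖x‖, νK (radialProjection (spherePt 1) x, w))) ≤ 1 := h.2
  linarith

/-- **The flow-out is injective on the band** (the level recovers `‖x‖`, then `Φ_s` and `νK` are
injective). [folklore] -/
theorem flowOut_inj {k : ℕ} {νK : (Metric.sphere (0 : EuclideanSpace ℝ (Fin 2)) 1) × (EuclideanSpace ℝ (Fin 2)) → (EuclideanSpace ℝ (Fin 4))} {Φ : ℝ × (EuclideanSpace ℝ (Fin 4)) → (EuclideanSpace ℝ (Fin 4))} {ε : ℝ}
    (hν : ContMDiff ((𝓡 1).prod 𝓘(ℝ, EuclideanSpace ℝ (Fin 2))) 𝓘(ℝ, EuclideanSpace ℝ (Fin 4)) ∞ νK)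
    (hνi : Injective νK)
    (hνd : ∀ p, Injective (mfderiv ((𝓡 1).prod 𝓘(ℝ, EuclideanSpace ℝ (Fin 2))) 𝓘(ℝ, EuclideanSpace ℝ (Fin 4)) νK p))
    (hνM : ∀ p, νK p ∈ modelBoundary k)
    (hΦs : ContDiff ℝ ∞ Φ) (h0 : ∀ x, Φ (0, x) = x) (hadd : ∀ s t x, Φ (s, Φ (t, x)) = Φ (s + t, x))
    (hclock : ∀ x ∈ modelBoundary k, ∀ s : ℝ, |s| ≤ 2 * ε →
      (∀ j, (1 : ℝ) / 2 < holeTerm k j (Φ (s, x))) ∧ levelFun k (Φ (s, x)) = 1 + s)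
    {x w x' w' : EuclideanSpace ℝ (Fin 2)} (hs : |1 - ‖x‖| ≤ 2 * ε) (hs' : |1 - ‖x'‖| ≤ 2 * ε)
    (h : Φ (1 - ‖x‖, νK (radialProjection (spherePt 1) x, w)) = Φ (1 - ‖x'‖, νK (radialProjection (spherePt 1) x', w'))) :
    x = x' ∧ w = w' := by
  obtain ⟨-, -, hinj, -⟩ := flowTube hν hνi hνd hνM hΦs h0 hadd hclock
  have key := hinj (1 - ‖x‖, (radialProjection (spherePt 1) x, w)) (1 - ‖x'‖, (radialProjection (spherePt 1) x', w')) hs hs' h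
  simp only [Prod.mk.injEq] at key
  obtain ⟨hn, hu, hw⟩ := key
  refine ⟨?_, hw⟩
  have hn' : ‖x‖ = ‖x'‖ := by linarith
  rw [← norm_smul_coe_radialProjection (spherePt 1) x, ← norm_smul_coe_radialProjection (spherePt 1) x', hu, hn']

/-- **The zero section of the flow-out is the flow of the knot**: `C(x, 0) = Φ(1 - ‖x‖, f₁(x/‖x‖))` for a
model slice disc `f₁` of `K₁` and a tube with zero section `K₁`. [folklore] -/
theorem flowOut_fst_zero {k : ℕ} {K₁ : (Metric.sphere (0 : EuclideanSpace ℝ (Fin 2)) 1) → (EuclideanSpace ℝ (Fin 4))} {f₁ : (EuclideanSpace ℝ (Fin 2)) → (EuclideanSpace ℝ (Fin 4))} {νK : (Metric.sphere (0 : EuclideanSpace ℝ (Fin 2)) 1) × (EuclideanSpace ℝ (Fin 2)) → (EuclideanSpace ℝ (Fin 4))} {Φ : ℝ × (EuclideanSpace ℝ (Fin 4)) → (EuclideanSpace ℝ (Fin 4))}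
    (hf : IsModelSliceDisc k K₁ f₁) (hν0 : ∀ u : (Metric.sphere (0 : EuclideanSpace ℝ (Fin 2)) 1), νK (u, 0) = K₁ u) (x : EuclideanSpace ℝ (Fin 2)) :
    Φ (1 - ‖x‖, νK (radialProjection (spherePt 1) x, 0)) = Φ (1 - ‖x‖, f₁ (unitVec x)) := by
  rw [hν0, ← hf.apply_sphere, unitVec]

end FriendsCarrierVk

open FriendsCarrierVk in
/-- **Helper `helper_friendsCarrier_Vk_partB_flowOut`** (piece of the registered stub
`helper_friendsCarrier_Vk_partB`: the flow-out of the knot tube in Cartesian coordinates).  For a `C^∞`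
injective immersion `νK : 𝕊¹ × ℝ² → M_k` and a clocked `C^∞` flow `Φ` with the group law, the map
`(x, w) ↦ Φ(1 - ‖x‖, νK(x/‖x‖, w))` is `C^∞` off `x = 0`, an immersion on the band `|1 - ‖x‖| < 2ε`,
injective on `|1 - ‖x‖| ≤ 2ε`, and lies there in the clock zone at level `2 - ‖x‖`. [folklore] -/
theorem helper_friendsCarrier_Vk_partB_flowOut : ∀ (k : ℕ) (νK : (Metric.sphere (0 : EuclideanSpace ℝ (Fin 2)) 1) × (EuclideanSpace ℝ (Fin 2)) → (EuclideanSpace ℝ (Fin 4))) (Φ : ℝ × (EuclideanSpace ℝ (Fin 4)) → (EuclideanSpace ℝ (Fin 4))) (ε : ℝ), ContMDiff ((𝓡 1).prod 𝓘(ℝ, EuclideanSpace ℝ (Fin 2))) 𝓘(ℝ, EuclideanSpace ℝ (Fin 4)) ((⊤ : ℕ∞) : WithTop ℕ∞) νK → Function.Injective νK → (∀ p, Function.Injective (mfderiv ((𝓡 1).prod 𝓘(ℝ, EuclideanSpace ℝ (Fin 2))) 𝓘(ℝ, EuclideanSpace ℝ (Fin 4)) νK p)) → (∀ p, νK p ∈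 modelBoundary k) → ContDiff ℝ ((⊤ : ℕ∞) : WithTop ℕ∞) Φ → (∀ x, Φ (0, x) = x) → (∀ s t x, Φ (s, Φ (t, x)) = Φ (s + t, x)) → (∀ x ∈ modelBoundary k, ∀ s : ℝ, |s| ≤ 2 * ε → (∀ j, (1 : ℝ) / 2 < holeTerm k j (Φ (s, x))) ∧ levelFun k (Φ (s, x)) = 1 + s) → (∀ q : (EuclideanSpace ℝ (Fin 2)) × (EuclideanSpace ℝ (Fin 2)), q.1 ≠ 0 → ContDiffAt ℝ ((⊤ : ℕ∞) : WithTop ℕ∞) (fun q : (EuclideanSpace ℝ (Fin 2)) × (EuclideanSpace ℝ (Fin 2)) => Φ (1 - ‖q.1‖, νK (radialProjection (spherePt 1) q.1, q.2))) q) ∧ (∀ x w : (EuclideanSpace ℝ (Fin 2)), x ≠ 0 → |1 - ‖x‖| < 2 * ε → Function.Injective (fderiv ℝ (fun q : (EuclideanSpace ℝ (Fin 2)) × (EuclideanSpace ℝ (Fin 2)) => Φ (1 - ‖q.1‖, νK (radialProjection (spherePt 1) q.1, q.2))) (x, w))) ∧ (∀ x w x' w' : (EuclideanSpace ℝ (Fin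 2)), |1 - ‖x‖| ≤ 2 * ε → |1 - ‖x'‖| ≤ 2 * ε → Φ (1 - ‖x‖, νK (radialProjection (spherePt 1) x, w)) = Φ (1 - ‖x'‖, νK (radialProjection (spherePt 1) x', w')) → x = x' ∧ w = w') ∧ (∀ x w : (EuclideanSpace ℝ (Fin 2)), |1 - ‖x‖| ≤ 2 * ε → (∀ j, (1 : ℝ) / 2 < holeTerm k j (Φ (1 - ‖x‖, νK (radialProjection (spherePt 1) x, w)))) ∧ levelFun k (Φ (1 - ‖x‖, νK (radialProjection (spherePt 1) x, w))) = 2 - ‖x‖) :=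
  fun _ _ _ _ hν hνi hνd hνM hΦs h0 hadd hclock =>
    ⟨fun _ hq => contDiffAt_flowOut hν hΦs hq,
      fun _ _ hx hs => injective_fderiv_flowOut hν hνi hνd hνM hΦs h0 hadd hclock hx hs,
      fun _ _ _ _ hs hs' h => flowOut_inj hν hνi hνd hνM hΦs h0 hadd hclock hs hs' h,
      fun _ w hs => flowOut_level hνM hclock w hs⟩

end Summit.SmoothPoincare4.SmoothPoincare4.Theorems.DcrGap.MkFriends

end
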